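import Summits.Schanuel.Schanuel.Theorems.RootDecomp1KW4Coprime02

/-! PORT (census-1 g29, ×0 RECORD PORT of the census kernel scratch «W4PURE» = HOME/census/tools/gen29/scratch/W4Pure.lean sha256
 fcd53bfa3f78138a…, 475 l (INSTRUMENT NOTE 75 L3378; writer g40 NOTE 26 L3380 second hand with a planted-false control, CONCUR; crit g14
 ACK + PRICE ×0 + PORT GO L3382 «NODE-34 / L3366 TERMS + K-R62», own CTRL (the norm identity is load-bearing) and PROBES P1–P5) —
 part 3 of the RootDecomp1KW4Coprime series (RootDecomp1KW4Coprime03): §6 the two explicit Runge functions at ∞₂ / ∞₁ cleared of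
 denominators (runN2, runN1), the NORM IDENTITY runN1·runN2 = 16T²b⁴(5a−b)(a+b) − 4(a⁴−17b⁴)·levelE0, the divisibilities
 T·b⁴ ∣ runN2 on the COPRIME class / T·b⁴ ∣ runN1 on the SQUARE class; §7 the size bound |runNᵢ| < T·b³·B(C). Statements and
 proofs VERBATIM from the scratch (no edit in this part). `--supports stmt-Schanuel-33364`; no census credit; ×0 record port; does
 NOT prove `LevelFinite W4P` / `ThinFibreAt m₀ W4P` / stmt-Schanuel-33364; the mixed class is open; row 36 UNDECIDED OF RECORD. -/

/-!
# RootDecomp1KW4Coprime — part 3: LEVEL FINITENESS FOR W4 ON THE TWO PURE CLASSES by «trivial Runge» with the explicit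
functions `φ₂ = z + Y³ − 2Y² − 6Y − 11 ∈ L(3∞₂)` and `φ₁ = −z + Y³ − 2Y² − 6Y − 11 ∈ L(3∞₁)` (`z = 2x(Y⁴ − 17) + Y³ + 1`),
whose product is `φ₁φ₂ = (Y³ − 2Y² − 6Y − 11)² − Δ(Y) = 16(5Y − 1)(Y + 1)` — the integer algebra (census-1 g29, ×0)

For a level point `(s_N, a/b)` of `W4P` with `p_N = b·c` (cofactor `c`): `φ₂ = Ñ₂/(2^{N!} b³)`, `φ₁ = Ñ₁/(2^{N!} b³)` with the
INTEGERS `Ñ₂ = runN2 a b c T = 2c(a⁴−17b⁴) + T(2a³ − 2a²b − 6ab² − 10b³)`, `Ñ₁ = runN1 a b c T = −2c(a⁴−17b⁴) − T(2a²b + 6ab² + 12b³)`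
(`T = 2^{N!}`), and the level equation (`levelE0 = 0`, part 01) gives `Ñ₁Ñ₂ = 16·T²·b⁴·(5a − b)(a + b)` EXACTLY.  On the
COPRIME class (`gcd(b, c) = 1`: the point never meets the branch `x ~ −1/Y²` of the node `(0, ∞)` at an odd prime) `b` is prime to
`Ñ₁ ≡ −2ca⁴ (mod b)`, so `b⁴ ∣ Ñ₂`; also `T ∣ a⁴ − 17b⁴ ∣`-wise `T ∣ Ñ₂`; hence `T·b⁴ ∣ Ñ₂`.  On the SQUARE class (`p_N = b²c'`,
cofactor `c = b·c'`, no coprimality needed: never meets `x ~ −1/Y`) `b` is prime to `Ñ₂ ≡ 2Ta³ (mod b)`, so `T·b⁴ ∣ Ñ₁`.  And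
`|Ñᵢ| < T·b³·B(C)` with `B(C) = denBound C = 4(C⁴+17) + 2C³ + 2C² + 6C + 13` when `|a| ≤ C·b` (uses `p_N < 2·2^{N!}`, tree
`psNumer_lt`).  Part 04 concludes: `den r < B(C)` on both classes, finitely many `r`, finitely many levels — LEVEL FINITENESS on
the pure classes and the clause of `ThinFibreAt m₀ W4P` there for EVERY `m₀`.  The MIXED class (`den r` meeting `p_N` at primes of
both kinds — both branches of `(0, ∞)`) is exactly where no function in `L(k∞₁) ∪ L(k∞₂)` has bounded denominator; it is untouched.

Rung 0: nothing here proves Schanuel, stmt-Schanuel-33364 / 33363 / 31077 / 31987, `ThinFibre 2`, `ThinFibreAt m₀ W4P` or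
`LevelFinite W4P`.  No Literature import, no fact def, no sorry, no set_option, no private.
-/

noncomputable section

open Polynomial LiouvilleNumber
open scoped Nat

namespace Summit.Schanuel.Schanuel.Theorems.RootDecomp1KW4Coprime

open Summit.Schanuel.Schanuel.Theorems.RootDecomp1KTwoBaseCell (psNumer partialSum_eq_psNumer_div coprime_psNumer)
open Summit.Schanuel.Schanuel.Theorems.RootDecomp1KRelLiouvilleCell (partialSum_two_strictMono)
open Summit.Schanuel.Schanuel.Theorems.RootDecomp1KDegreeLadder
open Summit.Schanuel.Schanuel.Theorems.RootDecomp1KOddEmpty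
open Summit.Schanuel.Schanuel.Theorems.RootDecomp1KRunge (psNumer_pos_runge)
open Summit.Schanuel.Schanuel.Theorems.RootDecomp1KLevelFinite (lac_partialSum_two)

/-! ### §6 The two Runge functions at `∞₂` / `∞₁`, cleared of denominators -/

/-- `Ñ₂ = 2^{N!}·b³·φ₂(P)` for `φ₂ = z + Y³ − 2Y² − 6Y − 11 ∈ L(3∞₂)`. -/
def runN2 (a b c T : ℤ) : ℤ :=
  2 * c * (a ^ 4 - 17 * b ^ 4) + T * (2 * a ^ 3 - 2 * a ^ 2 * b - 6 * a * b ^ 2 - 10 * b ^ 3)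

/-- `Ñ₁ = 2^{N!}·b³·φ₁(P)` for `φ₁ = −z + Y³ − 2Y² − 6Y − 11 ∈ L(3∞₁)`. -/
def runN1 (a b c T : ℤ) : ℤ :=
  -(2 * c * (a ^ 4 - 17 * b ^ 4)) - T * (2 * a ^ 2 * b + 6 * a * b ^ 2 + 12 * b ^ 3)

/-- THE NORM IDENTITY `φ₁φ₂ = 16(5Y − 1)(Y + 1)` cleared of denominators: `Ñ₁Ñ₂ = 16T²b⁴(5a−b)(a+b) − 4(a⁴−17b⁴)·levelE0`. -/
theorem runN1_mul_runN2 (a b c T : ℤ) :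
    runN1 a b c T * runN2 a b c T =
      16 * T ^ 2 * b ^ 4 * (5 * a - b) * (a + b) - 4 * (a ^ 4 - 17 * b ^ 4) * levelE0 a b c T := by
  unfold runN1 runN2 levelE0; ring

/-- `T ∣ a⁴ − 17b⁴` at a level point (`T = 2^{N!}` prime to `p_N = bc`). -/
theorem T_dvd_quartic {a b c T : ℤ} (hE : levelE a b (b * c) T = 0) (hpT : IsCoprime (b * c) T) :
    T ∣ a ^ 4 - 17 * b ^ 4 := by
  have h1 : T ∣ (a ^ 4 - 17 * b ^ 4) * (b * c) ^ 2 := by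
    refine ⟨-((a ^ 3 * b + b ^ 4) * (b * c) + (a * b ^ 3 + 2 * b ^ 4) * T), ?_⟩
    have : levelE a b (b * c) T = 0 := hE
    unfold levelE at this
    linear_combination this
  exact (hpT.symm.pow_right).dvd_of_dvd_mul_right h1

/-- COPRIME CLASS: `T·b⁴ ∣ Ñ₂`. -/
theorem dvd_runN2_of_coprime {a b c T : ℤ} (hb : b ≠ 0) (hE : levelE a b (b * c) T = 0)
    (hbc : IsCoprime b c) (hab : IsCoprime a b) (hb2 : IsCoprime b 2) (hpT : IsCoprime (b * c) T) :
    T * b ^ 4 ∣ runN2 a b c T := by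
  have hE0 : levelE0 a b c T = 0 := by
    have := levelE_eq a b c T
    rw [hE] at this
    rcases mul_eq_zero.mp this.symm with h | h
    · exact absurd (pow_eq_zero_iff two_ne_zero |>.mp h) hb
    · exact h
  have hprod : runN1 a b c T * runN2 a b c T = b ^ 4 * (16 * T ^ 2 * (5 * a - b) * (a + b)) := by
    rw [runN1_mul_runN2, hE0]; ring
  -- b is prime to Ñ₁ ≡ −2ca⁴ (mod b)
  have hcop : IsCoprime b (runN1 a b c T) := by
    have h1 : IsCoprime b (-(2 * c * a ^ 4)) :=
      ((hb2.mul_right hbc).mul_right (hab.symm.pow_right (n := 4))).neg_right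
    have e : runN1 a b c T = -(2 * c * a ^ 4) + b * (34 * c * b ^ 3 - T * (2 * a ^ 2 + 6 * a * b + 12 * b ^ 2)) := by
      unfold runN1; ring
    rw [e]
    exact h1.add_mul_left_right _
  have h4 : b ^ 4 ∣ runN2 a b c T :=
    (hcop.pow_left).dvd_of_dvd_mul_left (hprod ▸ Dvd.intro _ rfl)
  have hT : T ∣ runN2 a b c T := by
    obtain ⟨g, hg⟩ := T_dvd_quartic hE hpT
    refine ⟨2 * c * g + (2 * a ^ 3 - 2 * a ^ 2 * b - 6 * a * b ^ 2 - 10 * b ^ 3), ?_⟩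
    unfold runN2; rw [hg]; ring
  have hTb : IsCoprime T (b ^ 4) := (hpT.of_mul_left_left).symm.pow_right
  exact hTb.mul_dvd hT h4

/-- SQUARE CLASS (`p_N = b²·c'`, cofactor `c = b·c'`; no coprimality needed): `T·b⁴ ∣ Ñ₁`. -/
theorem dvd_runN1_of_square {a b c' T : ℤ} (hb : b ≠ 0) (hE : levelE a b (b * (b * c')) T = 0)
    (hab : IsCoprime a b) (hb2 : IsCoprime b 2) (hpT : IsCoprime (b * (b * c')) T) :
    T * b ^ 4 ∣ runN1 a b (b * c') T := by
  have hE0 : levelE0 a b (b * c') T = 0 := by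
    have := levelE_eq a b (b * c') T
    rw [hE] at this
    rcases mul_eq_zero.mp this.symm with h | h
    · exact absurd (pow_eq_zero_iff two_ne_zero |>.mp h) hb
    · exact h
  have hprod : runN2 a b (b * c') T * runN1 a b (b * c') T = b ^ 4 * (16 * T ^ 2 * (5 * a - b) * (a + b)) := by
    rw [mul_comm, runN1_mul_runN2, hE0]; ring
  -- b is prime to Ñ₂ ≡ 2Ta³ (mod b)
  have hbT : IsCoprime b T := (hpT.of_mul_left_left)
  have hcop : IsCoprime b (runN2 a b (b * c') T) := by
    have h1 : IsCoprime b (T * (2 * a ^ 3)) :=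
      hbT.mul_right (hb2.mul_right (hab.symm.pow_right (n := 3)))
    have e : runN2 a b (b * c') T =
        T * (2 * a ^ 3) + b * (2 * c' * (a ^ 4 - 17 * b ^ 4) - T * (2 * a ^ 2 + 6 * a * b + 10 * b ^ 2)) := by
      unfold runN2; ring
    rw [e]
    exact h1.add_mul_left_right _
  have h4 : b ^ 4 ∣ runN1 a b (b * c') T :=
    (hcop.pow_left).dvd_of_dvd_mul_left (hprod ▸ Dvd.intro _ rfl)
  have hT : T ∣ runN1 a b (b * c') T := by
    obtain ⟨g, hg⟩ := T_dvd_quartic hE hpT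
    refine ⟨-(2 * (b * c') * g) - (2 * a ^ 2 * b + 6 * a * b ^ 2 + 12 * b ^ 3), ?_⟩
    unfold runN1; rw [hg]; ring
  have hTb : IsCoprime T (b ^ 4) := hbT.symm.pow_right
  exact hTb.mul_dvd hT h4

/-! ### §7 Bounded denominators on the pure classes -/

/-- the bound: `B(C) = 4(C⁴ + 17) + 2C³ + 2C² + 6C + 13` (for `C ≥ 0`). -/
def denBound (C : ℝ) : ℝ := 4 * (C ^ 4 + 17) + 2 * C ^ 3 + 2 * C ^ 2 + 6 * C + 13

/-- the size of `Ñ₂` and `Ñ₁`: `|Ñᵢ| < T·b³·B(C)` when `|a| ≤ C·b`, `0 < bc < 2T`. -/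
theorem abs_runN_lt {a b c T : ℤ} {C : ℝ} (hC : 0 ≤ C) (hb : 0 < b) (hc : 0 < c) (hT : 0 < T)
    (hp : b * c < 2 * T) (haC : |(a : ℝ)| ≤ C * b) :
    |(runN2 a b c T : ℝ)| < T * (b : ℝ) ^ 3 * denBound C ∧
      |(runN1 a b c T : ℝ)| < T * (b : ℝ) ^ 3 * denBound C := by
  have hbR : (0 : ℝ) < b := by exact_mod_cast hb
  have hcR : (0 : ℝ) < c := by exact_mod_cast hc
  have hTR : (0 : ℝ) < T := by exact_mod_cast hT
  have hpR : (b : ℝ) * c < 2 * T := by exact_mod_cast hp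
  set A : ℝ := |(a : ℝ)| with hA
  have hA0 : 0 ≤ A := abs_nonneg _
  have hCb : 0 ≤ C * b := by positivity
  -- monomial bounds
  have m4 : A ^ 4 ≤ C ^ 4 * (b : ℝ) ^ 4 := by
    have := pow_le_pow_left₀ hA0 haC 4; rwa [mul_pow] at this
  have m3 : A ^ 3 ≤ C ^ 3 * (b : ℝ) ^ 3 := by
    have := pow_le_pow_left₀ hA0 haC 3; rwa [mul_pow] at this
  have m2 : A ^ 2 * b ≤ C ^ 2 * (b : ℝ) ^ 3 := by
    have h := pow_le_pow_left₀ hA0 haC 2; rw [mul_pow] at h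
    have := mul_le_mul_of_nonneg_right h hbR.le
    calc A ^ 2 * b ≤ C ^ 2 * (b:ℝ) ^ 2 * b := this
      _ = C ^ 2 * (b : ℝ) ^ 3 := by ring
  have m1 : A * (b : ℝ) ^ 2 ≤ C * (b : ℝ) ^ 3 := by
    have := mul_le_mul_of_nonneg_right haC (le_of_lt (pow_pos hbR 2))
    calc A * (b : ℝ) ^ 2 ≤ C * b * (b : ℝ) ^ 2 := this
      _ = C * (b : ℝ) ^ 3 := by ring
  -- |2c(a⁴ − 17b⁴)| ≤ 4T(C⁴+17)b³
  have hq : |((a : ℝ) ^ 4 - 17 * b ^ 4)| ≤ (C ^ 4 + 17) * (b : ℝ) ^ 4 := by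
    calc |((a : ℝ) ^ 4 - 17 * b ^ 4)| ≤ |(a : ℝ) ^ 4| + |(17 : ℝ) * b ^ 4| := abs_sub _ _
      _ = A ^ 4 + 17 * (b : ℝ) ^ 4 := by rw [abs_pow, abs_of_pos (by positivity : (0:ℝ) < 17 * (b:ℝ) ^ 4)]
      _ ≤ C ^ 4 * (b : ℝ) ^ 4 + 17 * (b : ℝ) ^ 4 := by linarith
      _ = (C ^ 4 + 17) * (b : ℝ) ^ 4 := by ring
  have hquart : |(2 : ℝ) * c * ((a : ℝ) ^ 4 - 17 * b ^ 4)| ≤ 4 * T * (C ^ 4 + 17) * (b : ℝ) ^ 3 := by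
    rw [abs_mul, abs_of_pos (by positivity : (0 : ℝ) < 2 * c)]
    have h1 : (2 : ℝ) * c * |((a : ℝ) ^ 4 - 17 * b ^ 4)| ≤ 2 * c * ((C ^ 4 + 17) * (b : ℝ) ^ 4) :=
      mul_le_mul_of_nonneg_left hq (by positivity)
    have hcb : (c : ℝ) * b ≤ 2 * T := by linarith [mul_comm (b : ℝ) c]
    have h2 : (2 : ℝ) * c * ((C ^ 4 + 17) * (b : ℝ) ^ 4) ≤ 4 * T * (C ^ 4 + 17) * (b : ℝ) ^ 3 := by
      have e : (2 : ℝ) * c * ((C ^ 4 + 17) * (b : ℝ) ^ 4) = (c * b) * (2 * (C ^ 4 + 17) * (b : ℝ) ^ 3) := by ring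
      rw [e]
      calc (c : ℝ) * b * (2 * (C ^ 4 + 17) * (b : ℝ) ^ 3)
          ≤ 2 * T * (2 * (C ^ 4 + 17) * (b : ℝ) ^ 3) := mul_le_mul_of_nonneg_right hcb (by positivity)
        _ = 4 * T * (C ^ 4 + 17) * (b : ℝ) ^ 3 := by ring
    exact h1.trans h2
  have hTb3 : (0 : ℝ) < T * (b : ℝ) ^ 3 := by positivity
  constructor
  · -- Ñ₂
    have hpoly : |(2 : ℝ) * a ^ 3 - 2 * a ^ 2 * b - 6 * a * (b : ℝ) ^ 2 - 10 * (b : ℝ) ^ 3|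
        ≤ (2 * C ^ 3 + 2 * C ^ 2 + 6 * C + 10) * (b : ℝ) ^ 3 := by
      have e1 : |(2 : ℝ) * a ^ 3| = 2 * A ^ 3 := by rw [abs_mul, abs_pow, abs_of_pos (by norm_num : (0:ℝ) < 2)]
      have e2 : |(2 : ℝ) * a ^ 2 * b| = 2 * A ^ 2 * b := by
        rw [abs_mul, abs_mul, abs_pow, abs_of_pos (by norm_num : (0:ℝ) < 2), abs_of_pos hbR]
      have e3 : |(6 : ℝ) * a * (b : ℝ) ^ 2| = 6 * A * (b : ℝ) ^ 2 := by
        rw [abs_mul, abs_mul, abs_of_pos (by norm_num : (0:ℝ) < 6), abs_of_pos (pow_pos hbR 2)]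
      have e4 : |(10 : ℝ) * (b : ℝ) ^ 3| = 10 * (b : ℝ) ^ 3 := abs_of_pos (by positivity)
      have t1 := abs_sub ((2 : ℝ) * a ^ 3 - 2 * a ^ 2 * b - 6 * a * (b : ℝ) ^ 2) (10 * (b : ℝ) ^ 3)
      have t2 := abs_sub ((2 : ℝ) * a ^ 3 - 2 * a ^ 2 * b) (6 * a * (b : ℝ) ^ 2)
      have t3 := abs_sub ((2 : ℝ) * a ^ 3) (2 * a ^ 2 * b)
      rw [e1] at t3; rw [e2] at t3; rw [e3] at t2; rw [e4] at t1
      nlinarith [m3, m2, m1, pow_pos hbR 3]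
    have hB : |(T : ℝ) * (2 * a ^ 3 - 2 * a ^ 2 * b - 6 * a * (b : ℝ) ^ 2 - 10 * (b : ℝ) ^ 3)| ≤
        T * ((2 * C ^ 3 + 2 * C ^ 2 + 6 * C + 10) * (b : ℝ) ^ 3) := by
      rw [abs_mul, abs_of_pos hTR]
      exact mul_le_mul_of_nonneg_left hpoly hTR.le
    have hsum : |(runN2 a b c T : ℝ)| ≤
        4 * T * (C ^ 4 + 17) * (b : ℝ) ^ 3 + T * ((2 * C ^ 3 + 2 * C ^ 2 + 6 * C + 10) * (b : ℝ) ^ 3) := by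
      unfold runN2; push_cast
      exact (abs_add_le _ _).trans (add_le_add hquart hB)
    calc |(runN2 a b c T : ℝ)| ≤ _ := hsum
      _ = T * (b : ℝ) ^ 3 * (4 * (C ^ 4 + 17) + 2 * C ^ 3 + 2 * C ^ 2 + 6 * C + 10) := by ring
      _ < T * (b : ℝ) ^ 3 * denBound C := by
          refine mul_lt_mul_of_pos_left ?_ hTb3
          unfold denBound; linarith
  · -- Ñ₁
    have hpoly : |(2 : ℝ) * a ^ 2 * b + 6 * a * (b : ℝ) ^ 2 + 12 * (b : ℝ) ^ 3|
        ≤ (2 * C ^ 2 + 6 * C + 12) * (b : ℝ) ^ 3 := by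
      have e2 : |(2 : ℝ) * a ^ 2 * b| = 2 * A ^ 2 * b := by
        rw [abs_mul, abs_mul, abs_pow, abs_of_pos (by norm_num : (0:ℝ) < 2), abs_of_pos hbR]
      have e3 : |(6 : ℝ) * a * (b : ℝ) ^ 2| = 6 * A * (b : ℝ) ^ 2 := by
        rw [abs_mul, abs_mul, abs_of_pos (by norm_num : (0:ℝ) < 6), abs_of_pos (pow_pos hbR 2)]
      have e4 : |(12 : ℝ) * (b : ℝ) ^ 3| = 12 * (b : ℝ) ^ 3 := abs_of_pos (by positivity)
      have t1 := abs_add_le ((2 : ℝ) * a ^ 2 * b + 6 * a * (b : ℝ) ^ 2) (12 * (b : ℝ) ^ 3)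
      have t2 := abs_add_le ((2 : ℝ) * a ^ 2 * b) (6 * a * (b : ℝ) ^ 2)
      rw [e2, e3] at t2; rw [e4] at t1
      nlinarith [m2, m1, pow_pos hbR 3]
    have hB : |(T : ℝ) * (2 * a ^ 2 * b + 6 * a * (b : ℝ) ^ 2 + 12 * (b : ℝ) ^ 3)| ≤
        T * ((2 * C ^ 2 + 6 * C + 12) * (b : ℝ) ^ 3) := by
      rw [abs_mul, abs_of_pos hTR]
      exact mul_le_mul_of_nonneg_left hpoly hTR.le
    have hsum : |(runN1 a b c T : ℝ)| ≤
        4 * T * (C ^ 4 + 17) * (b : ℝ) ^ 3 + T * ((2 * C ^ 2 + 6 * C + 12) * (b : ℝ) ^ 3) := by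
      unfold runN1; push_cast
      have e : -(2 * (c : ℝ) * ((a : ℝ) ^ 4 - 17 * (b : ℝ) ^ 4)) -
          (T : ℝ) * (2 * a ^ 2 * b + 6 * a * (b : ℝ) ^ 2 + 12 * (b : ℝ) ^ 3) =
          -((2 * (c : ℝ) * ((a : ℝ) ^ 4 - 17 * (b : ℝ) ^ 4)) +
            (T : ℝ) * (2 * a ^ 2 * b + 6 * a * (b : ℝ) ^ 2 + 12 * (b : ℝ) ^ 3)) := by ring
      rw [e, abs_neg]
      exact (abs_add_le _ _).trans (add_le_add hquart hB)
    calc |(runN1 a b c T : ℝ)| ≤ _ := hsum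
      _ = T * (b : ℝ) ^ 3 * (4 * (C ^ 4 + 17) + 2 * C ^ 2 + 6 * C + 12) := by ring
      _ < T * (b : ℝ) ^ 3 * denBound C := by
          refine mul_lt_mul_of_pos_left ?_ hTb3
          unfold denBound; nlinarith [pow_nonneg hC 3]

end Summit.Schanuel.Schanuel.Theorems.RootDecomp1KW4Coprime

end
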